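import Mathlib.Data.ZMod.QuotientRing
import Literature.NumberTheory.GaloisRepresentations.ModPGaloisRep
import HarnessLib

/-!
# Discharge of a named fact of `ModPGaloisRep.lean`: Serre's level is the prime-to-`p` part of the Artin conductor (trunk GalRep, item C15)

D-0014 keeps `Literature/` sorry-free by stating cited results as named facts `def X : Prop`.
This sibling file of `Literature.NumberTheory.GaloisRepresentations.ModPGaloisRep` (next to
`ModPGaloisRepProofs.lean` and `ModPGaloisRepKummerProofs.lean`) proves, as `theorem X_holds : X`,

* `Literature.NumberTheory.GaloisRepresentations.ModPGaloisRep.serreLevel_eq_artinConductorNat_div_holds` —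
  for a mod `p` representation `ρ̄ : Γ_ℚ → GL₂(k)`, Serre's level
  `N(ρ̄) = ∏_{ℓ ≠ p} ℓ ^ {n(ℓ, ρ̄)}` (`ModPGaloisRep.serreLevel`) equals the numerical Artin
  conductor `artinConductorNat ρ̄ = |𝔣(ρ̄)| = ∏_ℓ ℓ ^ {n(ℓ, ρ̄)}` (item C10) divided by its exact
  `p`-part `p ^ {v_p(|𝔣(ρ̄)|)}`.  This is Serre's *definition* of `N`: "L'entier `N` est
  simplement le conducteur d'Artin de `ρ`, défini comme en caractéristique `0`, à cela près que
  l'on se restreint aux places premières à `p`", `N = ∏_{l ≠ p} l^{n(l,ρ)}` (Duke Math. J. 54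
  (1987), §1.2, (1.2.3)); the content of the Lean statement is the bookkeeping identifying the
  two `finprod`s,

together with lemmas of independent use:

* `Literature.NumberTheory.GaloisRepresentations.GaloisRep.absNorm_finprod_rat`,
  `Literature.NumberTheory.GaloisRepresentations.GaloisRep.artinConductorNat_rat_eq_finprod` — for any Galois
  representation `ρ` of `Γ_ℚ`, `artinConductorNat ρ = ∏ᶠ_v (primesEquiv v) ^ {a_v(ρ)}`
  (rational primes via Mathlib's `Rat.HeightOneSpectrum.primesEquiv`; no finiteness
  hypothesis: `Ideal.absNorm` commutes with `finprod` because `absNorm I = 1` forces `I = ⊤`);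
* `Literature.NumberTheory.GaloisRepresentations.ModPGaloisRep.exists_artinConductorNat_eq_serreLevel_mul_pow` —
  `artinConductorNat ρ̄ = serreLevel p ρ̄ · p ^ e` for some `e`.

## Proof

Write `ℓ_v = primesEquiv v`, `a_v = artinConductorExponent v ρ̄`, `f v = ℓ_v ^ a_v` and
`g v = if ℓ_v = p then 1 else ℓ_v ^ a_v`, so that `artinConductorNat ρ̄ = ∏ᶠ f`
(`artinConductorNat_rat_eq_finprod`) and `serreLevel p ρ̄ = ∏ᶠ g` by definition.  If `f` has
finite multiplicative support, splitting off the factor at the place `v_p` above `p`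
(Mathlib `mul_finprod_cond_ne`) gives `∏ᶠ f = p ^ {a_{v_p}} · ∏ᶠ g`; otherwise `g` has infinite
support as well (the supports differ at most in `v_p`) and both `finprod`s take the junk value
`1`.  In either case `artinConductorNat ρ̄ = serreLevel p ρ̄ · p ^ e` for some `e`, and since
`p ∤ serreLevel p ρ̄` (`ModPGaloisRep.not_dvd_serreLevel`, proved in `ModPGaloisRep.lean`),
`v_p(artinConductorNat ρ̄) = e` (`Nat.factorization_mul`) and the exact division returns
`serreLevel p ρ̄`.  The hypothesis `IsUnramifiedAE` of the named fact is not needed.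

## References

* [Serre1987] J.-P. Serre, *Sur les représentations modulaires de degré 2 de `Gal(ℚ̄/ℚ)`*, Duke
  Math. J. 54 (1987), 179–230, §1.2 "Définition de `N`", (1.2.1)–(1.2.3) ("`N = ∏_{l≠p}
  l^{n(l,ρ)}` … par construction, `N` est premier à `p`"); read in *Œuvres* IV, no. 143,
  pp. 123–124.
* [SerreLocalFields1979] J.-P. Serre, *Local Fields*, GTM 67, Ch. VI §3 (the Artin conductor
  `𝔣(χ) = ∏ 𝔭 ^ {f(χ, 𝔭)}`).
-/

noncomputable section

open scoped NumberField
open IsDedekindDomain Rat.HeightOneSpectrum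

namespace Literature.NumberTheory.GaloisRepresentations

universe u v w

/-! ### The numerical Artin conductor over `ℚ` as a product of prime powers -/

namespace GaloisRep

variable {A : Type v} [CommRing A] [TopologicalSpace A]
  {M : Type w} [AddCommGroup M] [Module A M] [TopologicalSpace M]

/-- `Ideal.absNorm` commutes with `finprod` over ideals of `𝓞 ℚ`, with no finiteness
hypothesis: `absNorm I = 1` forces `I = ⊤` (`Ideal.absNorm_eq_one_iff`), so an infinite
multiplicative support stays infinite and both sides are then the junk value `1`
(`MonoidHom.map_finprod_of_preimage_one`). [folklore] -/
theorem absNorm_finprod_rat {ι : Type u} (g : ι → Ideal (𝓞 ℚ)) :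
    Ideal.absNorm (∏ᶠ i, g i) = ∏ᶠ i, Ideal.absNorm (g i) := by
  have hcoe : ∀ I, (Ideal.absNorm (S := 𝓞 ℚ)).toMonoidHom I = Ideal.absNorm I := fun _ ↦ rfl
  have h := MonoidHom.map_finprod_of_preimage_one (Ideal.absNorm (S := 𝓞 ℚ)).toMonoidHom
    (fun I hI ↦ by simpa [hcoe, Ideal.one_eq_top] using hI) g
  simpa only [hcoe] using h

/-- **The numerical Artin conductor over `ℚ` is `∏_ℓ ℓ ^ {a_ℓ(ρ)}`.**  For a Galois
representation `ρ` of `Γ_ℚ`, `artinConductorNat ρ = |𝔣(ρ)| = ∏ᶠ_v (primesEquiv v) ^ {a_v(ρ)}`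
as a `finprod` over the finite places `v` of `ℚ` (rational primes via
`Rat.HeightOneSpectrum.primesEquiv`); both sides are the junk value `1` when infinitely many
exponents are non-zero.  The norm of `𝔭_v` is computed as
`#(𝓞 ℚ ⧸ 𝔭_v) = #(ℤ ⧸ (p)) = #(ZMod p) = p`, `p = natGenerator v` (Mathlib
`Rat.HeightOneSpectrum.span_natGenerator`); the same computation is
`Literature.NumberTheory.LFunctions.absNorm_asIdeal_eq_primesEquiv`, whose module (the
Deligne–Serre development) is deliberately not imported here.
Ref: Serre, *Local Fields*, Ch. VI §3 (`𝔣(χ) = ∏ 𝔭 ^ {f(χ,𝔭)}`); Serre, Duke Math. J. 54 (1987),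
§1.2, (1.2.3). [folklore] -/
theorem artinConductorNat_rat_eq_finprod (ρ : GaloisRep ℚ A M) :
    ρ.artinConductorNat =
      ∏ᶠ v : HeightOneSpectrum (𝓞 ℚ), ((primesEquiv v : Nat.Primes) : ℕ) ^
        ρ.artinConductorExponent v := by
  rw [artinConductorNat, artinConductor, absNorm_finprod_rat]
  refine finprod_congr fun v => ?_
  -- `absNorm 𝔭_v = p`: `𝓞 ℚ ⧸ 𝔭_v ≃ ℤ ⧸ (p) ≃ ZMod p`
  have hv : Ideal.absNorm v.asIdeal = ((primesEquiv v : Nat.Primes) : ℕ) := by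
    change Ideal.absNorm v.asIdeal = natGenerator v
    rw [Ideal.absNorm_apply, Submodule.cardQuot_apply]
    have e : 𝓞 ℚ ⧸ v.asIdeal ≃+* ℤ ⧸ Ideal.span {(natGenerator v : ℤ)} :=
      Ideal.quotientEquiv _ _ (Rat.IsIntegralClosure.intEquiv (𝓞 ℚ)) (span_natGenerator v)
    rw [Nat.card_congr (e.trans (Int.quotientSpanNatEquivZMod _)).toEquiv, Nat.card_zmod]
  rw [map_pow, hv]

end GaloisRep

/-! ### The discharge -/

namespace ModPGaloisRep

/-- Elementary arithmetic: if `p ∤ S` (`p` prime) then `S` is recovered from `N = S · p ^ e` as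
`N / p ^ {v_p(N)}` (`v_p(N) = v_p(S) + e = e`, exact division). [folklore] -/
theorem eq_mul_pow_div_pow_factorization {p S : ℕ} (hp : p.Prime) (hS : ¬ p ∣ S) (e : ℕ) :
    S = S * p ^ e / p ^ (S * p ^ e).factorization p := by
  have hS0 : S ≠ 0 := by
    rintro rfl
    exact hS (dvd_zero p)
  rw [Nat.factorization_mul hS0 (pow_ne_zero e hp.ne_zero), Finsupp.add_apply,
    Nat.factorization_eq_zero_of_not_dvd hS, hp.factorization_pow, Finsupp.single_eq_same,
    zero_add, Nat.mul_div_cancel _ (pow_pos hp.pos e)]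

variable {k : Type v} [Field k] [TopologicalSpace k] [IsTopologicalRing k]
  (p : ℕ) [Fact p.Prime]

/-- **Key identity `|𝔣(ρ̄)| = N(ρ̄) · p ^ e`.**  For a mod `p` representation `ρ̄ : Γ_ℚ → GL₂(k)`
there is `e : ℕ` with `artinConductorNat ρ̄ = serreLevel p ρ̄ * p ^ e`: if the exponents
`a_v(ρ̄)` have finite support, split off the factor at the place `v_p` above `p`
(`mul_finprod_cond_ne`, `e = a_{v_p}(ρ̄)`); otherwise both `finprod`s are the junk value `1`
(`e = 0`).  Ref: Serre, Duke Math. J. 54 (1987), §1.2, (1.2.3). [folklore] -/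
theorem exists_artinConductorNat_eq_serreLevel_mul_pow (ρ : ModPGaloisRep ℚ k 2) :
    ∃ e : ℕ, (FramedGaloisRep.toGaloisRep ρ).artinConductorNat = serreLevel p ρ * p ^ e := by
  classical
  have hp : p.Prime := Fact.out
  -- notation: `P v = ℓ_v`, `a v = a_v(ρ̄)`, `f v = ℓ_v ^ a_v`, `vp` the place above `p`
  set a : HeightOneSpectrum (𝓞 ℚ) → ℕ :=
    fun v => (FramedGaloisRep.toGaloisRep ρ).artinConductorExponent v with ha
  set P : HeightOneSpectrum (𝓞 ℚ) → ℕ := fun v => ((primesEquiv v : Nat.Primes) : ℕ) with hP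
  set vp : HeightOneSpectrum (𝓞 ℚ) := (primesEquiv (R := 𝓞 ℚ)).symm ⟨p, hp⟩ with hvp
  have hPvp : P vp = p := by
    simp only [hP, hvp, Equiv.apply_symm_apply]
  have hP_iff : ∀ v, P v = p ↔ v = vp := fun v =>
    ⟨fun h => (primesEquiv (R := 𝓞 ℚ)).injective
        (by rw [hvp, Equiv.apply_symm_apply]; exact Subtype.ext h),
      fun h => h ▸ hPvp⟩
  have hN : (FramedGaloisRep.toGaloisRep ρ).artinConductorNat = ∏ᶠ v, P v ^ a v :=
    GaloisRep.artinConductorNat_rat_eq_finprod _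
  have hS : serreLevel p ρ = ∏ᶠ v, if P v = p then 1 else P v ^ a v := rfl
  -- the prime-to-`p` product is the product over `v ≠ vp`
  have hcond : (∏ᶠ (v) (_ : v ≠ vp), P v ^ a v) = ∏ᶠ v, if P v = p then 1 else P v ^ a v := by
    refine finprod_congr fun v => ?_
    rw [finprod_eq_if]
    by_cases hv : v = vp
    · rw [if_neg (not_not_intro hv), if_pos ((hP_iff v).2 hv)]
    · rw [if_pos hv, if_neg (mt (hP_iff v).1 hv)]
  by_cases hfin : (Function.mulSupport fun v => P v ^ a v).Finite
  · -- finite support: split off the factor at `vp`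
    refine ⟨a vp, ?_⟩
    rw [hN, hS, ← hcond, ← mul_finprod_cond_ne vp hfin, hPvp, mul_comm]
  · -- infinite support: both sides are the junk value `1`
    refine ⟨0, ?_⟩
    have hinf : (Function.mulSupport fun v => if P v = p then 1 else P v ^ a v).Infinite := by
      intro hg
      refine hfin ((hg.insert vp).subset fun v hv => ?_)
      rw [Function.mem_mulSupport] at hv
      by_cases hvv : v = vp
      · exact hvv ▸ Set.mem_insert _ _
      · refine Set.mem_insert_of_mem _ ?_
        rw [Function.mem_mulSupport, if_neg (mt (hP_iff v).1 hvv)]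
        exact hv
    rw [hN, hS, finprod_of_infinite_mulSupport hfin, finprod_of_infinite_mulSupport hinf,
      pow_zero, mul_one]

/-- **Discharge of `Literature.NumberTheory.GaloisRepresentations.ModPGaloisRep.serreLevel_eq_artinConductorNat_div`**
(item C15).  Serre's level `N(ρ̄) = ∏_{ℓ ≠ p} ℓ ^ {n(ℓ, ρ̄)}` of a mod `p` representation
`ρ̄ : Γ_ℚ → GL₂(k)` is the prime-to-`p` part of the numerical Artin conductor:
`serreLevel p ρ̄ = artinConductorNat ρ̄ / p ^ {v_p(artinConductorNat ρ̄)}`.  Serre *defines* `N`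
this way ("le conducteur d'Artin de `ρ` … à cela près que l'on se restreint aux places
premières à `p`", `N = ∏_{l ≠ p} l^{n(l,ρ)}`, "par construction, `N` est premier à `p`"); the
proof is `exists_artinConductorNat_eq_serreLevel_mul_pow` (`|𝔣(ρ̄)| = N(ρ̄) · p ^ e`),
`not_dvd_serreLevel` (`p ∤ N(ρ̄)`) and `eq_mul_pow_div_pow_factorization`.  The hypothesis
`IsUnramifiedAE` of the named fact is not used (for infinite support both sides are `1`).
Ref: Serre, Duke Math. J. 54 (1987), §1.2, (1.2.1)–(1.2.3).
[cite: Serre1987, §1.2, (1.2.3)] -/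
theorem serreLevel_eq_artinConductorNat_div_holds :
    serreLevel_eq_artinConductorNat_div (k := k) p := by
  intro ρ _
  obtain ⟨e, he⟩ := exists_artinConductorNat_eq_serreLevel_mul_pow p ρ
  rw [he]
  exact eq_mul_pow_div_pow_factorization Fact.out (not_dvd_serreLevel p ρ) e

end ModPGaloisRep

end Literature.NumberTheory.GaloisRepresentations
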